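import Literature.AlgebraicGeometry.Morphisms.ProjectiveOfPushforwardFrame
import Literature.AlgebraicGeometry.Morphisms.ProjectiveOverBaseOfFibresEmbedding
import Literature.AlgebraicGeometry.Motives.GeneratingSectionsFrameChange
import HarnessLib

/-!
# The frame of `f_*E` and the morphism to `ℙⁿ` it defines COMMUTE WITH BASE CHANGE

Topic `AlgebraicGeometry/Morphisms`; namespace `Literature.AlgebraicGeometry.Morphisms`. THEOREMS ONLY (no definition,
no named fact, no instance, no notation, no `sorry`).

Setting ([Hartshorne1977] III Prop. 9.3 / Thm. 12.11, [MumfordAV1970] §5 Cor. 3, [EGAIII1] 4.7.1): `T` locally noetherian,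
`f : X → T` proper and flat, `E` a finite locally free `𝒪_X`-module with `Ext¹(𝒪, E|fibre) = 0` on every fibre over a
field point, `e : 𝒪_T^ι ≅ f_*E` a (global) FRAME of the direct image with basis sections `b_j ∈ Γ(X, E)`, and a CARTESIAN
square `G ≫ f = f′ ≫ u` (`X′ = X ×_T T′`, ANY `T′`), together with an isomorphism `φ : G^*E ≅ E′` of `𝒪_{X′}`-modules.

* §1 **`exists_frame_basisSection_eq_of_isPullback`** — the frame TRANSPORTS: there is a frame `e′ : 𝒪_{T′}^ι ≅ f′_*E′`
  whose basis sections are `φ(η_G(b_j))` (cohomology and base change for the framed `f_*E` along the square, ★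
  `Modules.isIso_pushforwardBaseChangeHom_of_forall_fieldPoint` — `f_*E` is affine-localizing because it is framed, ★
  `isFiniteLocallyFree_pushforward_of_frame`; the frame is `η_u(e) ≫ β ≫ f′_*φ`, ★ `pullbackFrame`/`basisSection_pullbackFrame`,
  ★ `pushforwardBaseChangeHom_app_unitSectionLE`).
* §2 for `E` carrying a rank-one frame system `F` (so the `b_j`, if they generate, define `X → ℙⁿ`, Hartshorne II 7.1)
  and ANY rank-one frame system `F′` of `E′`: **`exists_frame_ofCocycleSections_eq_comap`** — the generating-sections
  datum of the transported frame `e′` in `F′` IS the pull-back along `G` of the datum of `e` in `F` (★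
  `iSup_basicOpen_coeffAt_pullback_eq_top`, ★ `ofCocycleSections_ofFrameSystem_pullback`, ★ (W)
  `ofCocycleSections_ofFrameSystem_eq_of_iso`, ★ `ofCocycleSections_comap`); hence
  **`exists_frame_toProj_eq_comp`** — `toProj` of `e′` is `G ≫ toProj` of `e` — and, in the letter of ★
  `Morphisms.projectiveSpace.pointOfSections`, **`exists_frame_homEquiv_pointOfSections_eq_comp`**: the
  `𝐏ⁿ_ℤ`-component of the point of `𝐏(J; T′)` defined by `e′` is `G ≫` that of the point of `𝐏(J; T)` defined by `e`
  («the morphism to `ℙⁿ` of `(G^*𝓛, G^*s)` is `X′ → X → ℙⁿ`», Hartshorne II 7.1, for the frame sections).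

Cell `hodgecm-mathlib`, F-DAG F-8: the generic half of (hBC) «linear rigidifications pull back along relations» (consumers:
(8β-b) `preimage_frameOpen`, (8γ-U) `exists_openCover_GL_of_isLinearRigidification`); instantiated for polarised abelian
schemes with level structure in `ModuliOfAbelianVarieties/SiegelLinearRigidificationBaseChange`.  Count-neutral: HC_CM is
proved only modulo the 7 printed citations until rung 0 closes — nothing here bears on a summit statement.

## References
* R. Hartshorne, *Algebraic Geometry*, GTM 52 (1977): II Thm. 7.1 (p. 150), II §5 (p. 110), III Prop. 9.3 (p. 255),
  III Thm. 12.11 (p. 290). [Hartshorne1977]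
* D. Mumford, *Abelian Varieties* (1970), §5 Cor. 3 (p. 53). [MumfordAV1970]
* A. Grothendieck, J. Dieudonné, *EGA III₁* (Publ. Math. IHÉS 11, 1961), Thm. 4.7.1. [EGAIII1]
-/

noncomputable section

-- `Scheme.Modules` section API and pull-back bookkeeping across semireducible wrappers (as in ★ `Morphisms/ProjectiveOfPushforwardFrame`).
set_option backward.isDefEq.respectTransparency false

open CategoryTheory CategoryTheory.Limits CategoryTheory.Abelian AlgebraicGeometry TopologicalSpace Opposite
open Literature.AlgebraicGeometry.Modules
open Literature.AlgebraicGeometry.Motives Literature.AlgebraicGeometry.Motives.GeneratingSections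

namespace Literature.AlgebraicGeometry.Morphisms

/-! ## §1 The frame of `f_*E` transports along a cartesian square -/

section Frame

variable {X T X' T' : Scheme.{0}} [IsLocallyNoetherian T] (f : X ⟶ T) [IsProper f] [Flat f]
  {G : X' ⟶ X} {f' : X' ⟶ T'} {u : T' ⟶ T} (H : IsPullback G f' f u)
  (E : X.Modules) (hL : IsFiniteLocallyFree E) {ι : Type} [Fintype ι]
  (e : SheafOfModules.free ι ≅ ((Scheme.Modules.pushforward f).obj E).over ⊤)
  (hvan : ∀ ⦃K : Type⦄ [Field K] ⦃X₀ : Scheme.{0}⦄ (i : X₀ ⟶ X) (f₀ : X₀ ⟶ Spec (CommRingCat.of K))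
    (x : Spec (CommRingCat.of K) ⟶ T), IsPullback i f₀ f x →
      Subsingleton (Ext.{1} (unitModule X₀) ((Scheme.Modules.pullback i).obj E) 1))
  {E' : X'.Modules} (φ : (Scheme.Modules.pullback G).obj E ≅ E')

omit [IsLocallyNoetherian T] [IsProper f] [Flat f] in
/-- The basis sections of a frame followed by an isomorphism of modules are the images of the basis sections.
[cite: Hartshorne1977, II §5 (p. 110)] -/
private theorem basisSection_trans_mapIso {Y : Scheme.{0}} {M M' : Y.Modules} {W : Y.Opens} {I : Type}
    (e₁ : SheafOfModules.free I ≅ M.over W) (ψ : M ≅ M') (l : I) :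
    basisSection (e₁ ≪≫ (SheafOfModules.overFunctor _ W).mapIso ψ) l = ψ.hom.app W (basisSection e₁ l) := by
  rw [basisSection, basisSection, Iso.trans_hom, SheafOfModules.freeHomEquiv_comp_apply,
    overSectionsEquiv_sectionsMap', Functor.mapIso_hom, appLE_over_map]

include hL hvan H in
/-- **The frame of `f_*E` TRANSPORTS along a cartesian square** (`T` locally noetherian, `f` proper flat, `E` finite locally
free with fibrewise `Ext¹(𝒪, E|fibre) = 0` over field points; `G ≫ f = f′ ≫ u` cartesian; `φ : G^*E ≅ E′`): there is a frame
`e′ : 𝒪_{T′}^ι ≅ f′_*E′` whose basis sections are `φ(η_G(b_j))`, the images of the pulled-back basis sections `b_j` of `e`.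
Construction: the base-change morphism `β : u^*(f_*E) → f′_*(G^*E)` is an isomorphism (cohomology and base change, ★
`Modules.isIso_pushforwardBaseChangeHom_of_forall_fieldPoint`; `f_*E` is affine-localizing since framed), and
`e′ := η_u(e) ≫ β ≫ f′_*φ` (★ `pullbackFrame`; `β(η_u(b_j)) = η_G(b_j)`, ★ `pushforwardBaseChangeHom_app_unitSectionLE`).
[cite: Hartshorne1977, III Thm. 12.11 (p. 290) and III Prop. 9.3 (p. 255)] [cite: MumfordAV1970, §5 Cor. 3 (p. 53)] -/
theorem exists_frame_basisSection_eq_of_isPullback :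
    ∃ e' : SheafOfModules.free ι ≅ ((Scheme.Modules.pushforward f').obj E').over ⊤,
      ∀ j, (show Γ(E', ⊤) from (basisSection e' j :)) =
        φ.hom.app ⊤ (unitSectionLE G E (V := ⊤) (U := ⊤) le_top (basisSection e j :)) := by
  haveI : IsIso (pushforwardBaseChangeHom H.w E) :=
    isIso_pushforwardBaseChangeHom_of_forall_fieldPoint E hL
      (isAffineLocalizing_of_isFiniteLocallyFree (isFiniteLocallyFree_pushforward_of_frame f E e)) hvan H
  -- `β ≫ f'_*φ : u^*(f_*E) ≅ f'_*E'`
  let ψ : (Scheme.Modules.pullback u).obj ((Scheme.Modules.pushforward f).obj E) ≅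
      (Scheme.Modules.pushforward f').obj E' :=
    asIso (pushforwardBaseChangeHom H.w E) ≪≫ (Scheme.Modules.pushforward f').mapIso φ
  -- the pulled-back frame `η_u(e)` over `u⁻¹(⊤)`, restricted to `⊤`, followed by `ψ`
  have htop : (⊤ : T'.Opens) ≤ u ⁻¹ᵁ ⊤ := le_top
  let e₁ := pullbackFrame u e
  let e₀ := SheafOfModules.restrictTrivialisation (R := T'.ringCatSheaf) (homOfLE htop) e₁
  refine ⟨e₀ ≪≫ (SheafOfModules.overFunctor _ (⊤ : T'.Opens)).mapIso ψ, fun j ↦ ?_⟩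
  change basisSection (e₀ ≪≫ (SheafOfModules.overFunctor _ (⊤ : T'.Opens)).mapIso ψ) j = _
  rw [basisSection_trans_mapIso]
  change ((pushforwardBaseChangeHom H.w E) ≫ (Scheme.Modules.pushforward f').map φ.hom).app ⊤
      (basisSection (SheafOfModules.restrictTrivialisation (R := T'.ringCatSheaf) (homOfLE htop) e₁) j) = _
  rw [Scheme.Modules.Hom.comp_app, CategoryTheory.comp_apply, Scheme.Modules.pushforward_map_app,
    basisSection_restrictTrivialisation]
  change φ.hom.app _ ((pushforwardBaseChangeHom H.w E).app ⊤
    (((Scheme.Modules.pullback u).obj ((Scheme.Modules.pushforward f).obj E)).presheaf.map (homOfLE htop).op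
      (basisSection (pullbackFrame u e) j))) = _
  rw [basisSection_pullbackFrame]
  -- `β(η_u(b_j)|_⊤) = η_G(b_j)|_⊤`
  have hβ := pushforwardBaseChangeHom_app_unitSectionLE H.w E (V := ⊤) (W := ⊤) le_top (basisSection e j :)
  rw [unitSectionLE] at hβ
  erw [hβ]
  rfl

end Frame

/-! ## §2 The morphism to `ℙⁿ` of the frame sections commutes with base change -/

section Datum

variable {X T X' T' : Scheme.{0}} [IsLocallyNoetherian T] (f : X ⟶ T) [IsProper f] [Flat f]
  {G : X' ⟶ X} {f' : X' ⟶ T'} {u : T' ⟶ T} (H : IsPullback G f' f u)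
  {E : X.Modules} (F : FrameSystem E) (h1 : ∀ x, F.rank x = 1) {n : ℕ}
  (e : SheafOfModules.free (Fin (n + 1)) ≅ ((Scheme.Modules.pushforward f).obj E).over ⊤)
  (hvan : ∀ ⦃K : Type⦄ [Field K] ⦃X₀ : Scheme.{0}⦄ (i : X₀ ⟶ X) (f₀ : X₀ ⟶ Spec (CommRingCat.of K))
    (x : Spec (CommRingCat.of K) ⟶ T), IsPullback i f₀ f x →
      Subsingleton (Ext.{1} (unitModule X₀) ((Scheme.Modules.pullback i).obj E) 1))
  (hcov : ⨆ i, ⨆ x, X.basicOpen ((CocycleSections.ofFrameSystem F h1 fun j ↦ (basisSection e j :)).coeff i x) = ⊤)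
  {E' : X'.Modules} (φ : (Scheme.Modules.pullback G).obj E ≅ E') (F' : FrameSystem E') (h1' : ∀ x, F'.rank x = 1)

include hvan H hcov φ in
/-- **The generating-sections datum of the frame sections COMMUTES WITH BASE CHANGE** (Hartshorne II Thm. 7.1: the morphism
to `ℙⁿ` of `(G^*𝓛, G^*s_j)` is `X′ → X → ℙⁿ`): for a rank-one frame system `F` of `E` whose frame sections `b_j` generate, and
ANY rank-one frame system `F′` of `E′ ≅ G^*E`, the transported frame `e′` of §1 has generating basis sections and their datum in
`F′` is the pull-back `(–).comap G` of the datum of the `b_j` in `F` — generation pulls back (★ `iSup_basicOpen_coeffAt_pullback_eq_top`),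
the pulled-back sections in the pulled-back frames give the pulled-back datum (★ `ofCocycleSections_ofFrameSystem_pullback`,
★ `ofCocycleSections_comap`), and the datum sees neither `φ` nor the frame system (★ `ofCocycleSections_ofFrameSystem_eq_of_iso`).
[cite: Hartshorne1977, II Thm. 7.1 (p. 150)] [cite: MumfordAV1970, §5 Cor. 3 (p. 53)] -/
theorem exists_frame_ofCocycleSections_eq_comap :
    ∃ (e' : SheafOfModules.free (Fin (n + 1)) ≅ ((Scheme.Modules.pushforward f').obj E').over ⊤)
      (hcov' : ⨆ i, ⨆ x, X'.basicOpen
        ((CocycleSections.ofFrameSystem F' h1' fun j ↦ (basisSection e' j :)).coeff i x) = ⊤),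
      ofCocycleSections F'.U (CocycleSections.ofFrameSystem F' h1' fun j ↦ (basisSection e' j :)) hcov' =
        (ofCocycleSections F.U (CocycleSections.ofFrameSystem F h1 fun j ↦ (basisSection e j :)) hcov).comap G := by
  obtain ⟨e', he'⟩ := exists_frame_basisSection_eq_of_isPullback f H E F.isFiniteLocallyFree e hvan φ
  -- abbreviations: the frame sections and their pull-backs
  set t : Fin (n + 1) → Γ(E, ⊤) := fun j ↦ (basisSection e j :) with ht
  let tG : Fin (n + 1) → Γ((Scheme.Modules.pullback G).obj E, ⊤) :=
    fun j ↦ unitSectionLE G E (V := ⊤) (U := ⊤) le_top (t j)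
  have h1G : ∀ x, (F.pullback G).rank x = 1 := fun x ↦ h1 (G.base x)
  -- generation pulls back
  have hcovG : ⨆ i, ⨆ x, X'.basicOpen ((CocycleSections.ofFrameSystem (F.pullback G) h1G tG).coeff i x) = ⊤ := by
    simp only [CocycleSections.ofFrameSystem_coeff]
    refine iSup_basicOpen_coeffAt_pullback_eq_top F h1 t G h1G ?_
    simpa only [CocycleSections.ofFrameSystem_coeff] using hcov
  -- the datum of the `φ(η_G(b_j))` in `F'` is the datum of the `η_G(b_j)` in the pulled-back frames …
  obtain ⟨hcovφ, heqφ⟩ := ofCocycleSections_ofFrameSystem_eq_of_iso φ (F.pullback G) F' h1G h1' tG hcovG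
  -- … which is the pulled-back datum
  have hcov₀ := iSup_basicOpen_comap_coeff_eq_top_of_pullback G F h1 t h1G hcovG
  have key := ofCocycleSections_ofFrameSystem_pullback G F h1 t h1G hcovG hcov₀
  have hcomap := ofCocycleSections_comap G (CocycleSections.ofFrameSystem F h1 t) hcov
  -- the basis sections of `e'` ARE the `φ(η_G(b_j))`
  have hs : (fun j ↦ (show Γ(E', ⊤) from (basisSection e' j :))) = fun j ↦ φ.hom.app ⊤ (tG j) := funext he'
  have main : ∃ (hcov' : ⨆ i, ⨆ x, X'.basicOpen
      ((CocycleSections.ofFrameSystem F' h1' fun j ↦ φ.hom.app ⊤ (tG j)).coeff i x) = ⊤),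
      ofCocycleSections F'.U (CocycleSections.ofFrameSystem F' h1' fun j ↦ φ.hom.app ⊤ (tG j)) hcov' =
        (ofCocycleSections F.U (CocycleSections.ofFrameSystem F h1 t) hcov).comap G :=
    ⟨hcovφ, heqφ.symm.trans (key.trans (hcomap ▸ rfl))⟩
  rw [← hs] at main
  exact ⟨e', main⟩

include hvan H hcov φ in
/-- **`toProj` of the transported frame is `G ≫ toProj` of the frame** (over any base `Spec A` under `X`).
[cite: Hartshorne1977, II Thm. 7.1 (p. 150)] -/
theorem exists_frame_toProj_eq_comp {A : Type} [CommRing A] (k : X ⟶ Spec (.of A)) :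
    ∃ (e' : SheafOfModules.free (Fin (n + 1)) ≅ ((Scheme.Modules.pushforward f').obj E').over ⊤)
      (hcov' : ⨆ i, ⨆ x, X'.basicOpen
        ((CocycleSections.ofFrameSystem F' h1' fun j ↦ (basisSection e' j :)).coeff i x) = ⊤),
      (ofCocycleSections F'.U (CocycleSections.ofFrameSystem F' h1' fun j ↦ (basisSection e' j :)) hcov').toProj (G ≫ k) =
        G ≫ (ofCocycleSections F.U (CocycleSections.ofFrameSystem F h1 fun j ↦ (basisSection e j :)) hcov).toProj k := by
  obtain ⟨e', hcov', heq⟩ := exists_frame_ofCocycleSections_eq_comap f H F h1 e hvan hcov φ F' h1'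
  refine ⟨e', hcov', ?_⟩
  rw [heq, comap_toProj]

include hvan H φ in
/-- **The point of projective space defined by the frame sections commutes with base change**, in the letter of ★
`Morphisms.projectiveSpace.pointOfSections` / `homEquiv` (`𝐏(J; T)(X) = 𝐏ⁿ_ℤ(X)`, `n = #J`): the `𝐏ⁿ_ℤ`-component of the
`T′`-point of `𝐏(J; T′)` defined on `X′` by the transported frame `e′` is `G ≫` the `𝐏ⁿ_ℤ`-component of the `T`-point of
`𝐏(J; T)` defined on `X` by `e`. [cite: Hartshorne1977, II Thm. 7.1 (p. 150)] -/
theorem exists_frame_homEquiv_pointOfSections_eq_comp (J : Type)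
    (eJ : SheafOfModules.free (Fin (Nat.card J + 1)) ≅ ((Scheme.Modules.pushforward f).obj E).over ⊤)
    (hcovJ : ⨆ i, ⨆ x, X.basicOpen
      ((CocycleSections.ofFrameSystem F h1 fun j ↦ (basisSection eJ j :)).coeff i x) = ⊤) :
    ∃ (e' : SheafOfModules.free (Fin (Nat.card J + 1)) ≅ ((Scheme.Modules.pushforward f').obj E').over ⊤)
      (hcov' : ⨆ i, ⨆ x, X'.basicOpen
        ((CocycleSections.ofFrameSystem F' h1' fun j ↦ (basisSection e' j :)).coeff i x) = ⊤),
      projectiveSpace.homEquiv (Over.mk f')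
          (projectiveSpace.pointOfSections (Over.mk f')
            (ofCocycleSections F'.U (CocycleSections.ofFrameSystem F' h1' fun j ↦ (basisSection e' j :)) hcov')) =
        G ≫ projectiveSpace.homEquiv (Over.mk f)
          (projectiveSpace.pointOfSections (Over.mk f)
            (ofCocycleSections F.U (CocycleSections.ofFrameSystem F h1 fun j ↦ (basisSection eJ j :)) hcovJ)) := by
  obtain ⟨e', hcov', heq⟩ := exists_frame_toProj_eq_comp f H F h1 eJ hvan hcovJ φ F' h1'
    (specULiftZIsTerminal.from X)
  refine ⟨e', hcov', ?_⟩
  rw [projectiveSpace.homEquiv_pointOfSections, projectiveSpace.homEquiv_pointOfSections]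
  change (ofCocycleSections F'.U _ hcov').toProj (specULiftZIsTerminal.from X') = _
  rw [specULiftZIsTerminal.hom_ext (specULiftZIsTerminal.from X') (G ≫ specULiftZIsTerminal.from X)]
  exact heq

end Datum

end Literature.AlgebraicGeometry.Morphisms

end
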